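import Summits.Ventures.WeilGRH.UniformConductorFloorCoprimeDataLog8
import Summits.Ventures.WeilGRH.UniformConductorFloorJointFloorsLog8
import Summits.Ventures.WeilGRH.UniformConductorFloorJointFloorsLog9
import Summits.Ventures.WeilGRH.UniformConductorFloorCellsOne
import Summits.Ventures.WeilGRH.UniformConductorFloorRungs
import HarnessLib

/-!
# GRH arm (rh-explicit, venture WeilGRH): divisibility floors at `t = (log 8)/2` — the transcendental inputs of the level-`m` certificates

Cell `rh-explicit`, WEIL TRACK — GRH ARM (weil-grh-1, gen7).  For the six joint cell certificates of `UniformConductorFloorCoprimeDataLog8.lean`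
(level `m ∈ {2, 3, 6}`, grid `R = 320`, `J = 333`, prime powers `n ≤ 8`): the weight bounds on the `n` PRIME TO `m`
(`UniformFloor.wbar7_ge`, `vonMangoldt_eight_div_sqrt_le`, `vonMangoldt_nine_div_sqrt_le`; the other weights are `0`), the window
`(log 8)/2 ≤ t = 333 log(320/319)` is the tree's `UniformFloor.log8half_le_t` (`UniformConductorFloorJointFloorsLog8.lean`, same grid), and the six budget inequalities
`log π − ψ₀ − Clow/D + RHO/D ≤ log Q₀` (`certEvenDvd2Log8` → Q₀ = 42; `certOddDvd2Log8` → Q₀ = 16; `certEvenDvd3Log8` → Q₀ = 54; `certOddDvd3Log8` → Q₀ = 21; `certEvenDvd6Log8` → Q₀ = 24; `certOddDvd6Log8` → Q₀ = 12; elementary logarithm bounds from `log 2`, `log 3` inline).  Consumed by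
`UniformConductorFloorCoprimeFloorsLog8.lean`.  No definitions; no named facts; standard axioms. [folklore]
-/

noncomputable section

open Real Set
open scoped ArithmeticFunction.vonMangoldt

namespace Summit.Ventures.WeilGRH

open Literature.NumberTheory.LFunctions

namespace UniformFloor

/-- The weights of `certEvenDvd2Log8` dominate `Λ(n)/√n` on the `n ≤ 8` prime to `2`; the other weights are `0`. [folklore] -/
theorem certEvenDvd2Log8_hw : ∀ n ∈ Finset.range (certEvenDvd2Log8.N + 1),
    (if n.Coprime 2 then (Λ n : ℝ) / Real.sqrt n else 0) ≤ certEvenDvd2Log8.wbar n := by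
  intro n hn
  have hnN : n < 9 := by simpa [show certEvenDvd2Log8.N = 8 from rfl] using Finset.mem_range.1 hn
  have h7 : ∀ k < 8, (Λ k : ℝ) / Real.sqrt k ≤ wbar7 k := fun k hk ↦
    wbar7_ge 7 le_rfl k (Finset.mem_range.2 (by omega))
  unfold JointCert.wbar
  rw [show certEvenDvd2Log8.D = 1048576 from rfl]
  interval_cases n
  · rw [if_neg (by decide), show certEvenDvd2Log8.weights.getD 0 0 = 0 from rfl]
    norm_num
  · rw [if_pos (by decide), show certEvenDvd2Log8.weights.getD 1 0 = 0 from rfl]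
    exact (h7 1 (by norm_num)).trans (by norm_num [wbar7])
  · rw [if_neg (by decide), show certEvenDvd2Log8.weights.getD 2 0 = 0 from rfl]
    norm_num
  · rw [if_pos (by decide), show certEvenDvd2Log8.weights.getD 3 0 = 665112 from rfl]
    exact (h7 3 (by norm_num)).trans (by norm_num [wbar7])
  · rw [if_neg (by decide), show certEvenDvd2Log8.weights.getD 4 0 = 0 from rfl]
    norm_num
  · rw [if_pos (by decide), show certEvenDvd2Log8.weights.getD 5 0 = 754726 from rfl]
    exact (h7 5 (by norm_num)).trans (by norm_num [wbar7])
  · rw [if_neg (by decide), show certEvenDvd2Log8.weights.getD 6 0 = 0 from rfl]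
    norm_num
  · rw [if_pos (by decide), show certEvenDvd2Log8.weights.getD 7 0 = 771213 from rfl]
    exact (h7 7 (by norm_num)).trans (by norm_num [wbar7])
  · rw [if_neg (by decide), show certEvenDvd2Log8.weights.getD 8 0 = 0 from rfl]
    norm_num

/-- The weights of `certOddDvd2Log8` dominate `Λ(n)/√n` on the `n ≤ 8` prime to `2`; the other weights are `0`. [folklore] -/
theorem certOddDvd2Log8_hw : ∀ n ∈ Finset.range (certOddDvd2Log8.N + 1),
    (if n.Coprime 2 then (Λ n : ℝ) / Real.sqrt n else 0) ≤ certOddDvd2Log8.wbar n := by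
  intro n hn
  have hnN : n < 9 := by simpa [show certOddDvd2Log8.N = 8 from rfl] using Finset.mem_range.1 hn
  have h7 : ∀ k < 8, (Λ k : ℝ) / Real.sqrt k ≤ wbar7 k := fun k hk ↦
    wbar7_ge 7 le_rfl k (Finset.mem_range.2 (by omega))
  unfold JointCert.wbar
  rw [show certOddDvd2Log8.D = 1048576 from rfl]
  interval_cases n
  · rw [if_neg (by decide), show certOddDvd2Log8.weights.getD 0 0 = 0 from rfl]
    norm_num
  · rw [if_pos (by decide), show certOddDvd2Log8.weights.getD 1 0 = 0 from rfl]
    exact (h7 1 (by norm_num)).trans (by norm_num [wbar7])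
  · rw [if_neg (by decide), show certOddDvd2Log8.weights.getD 2 0 = 0 from rfl]
    norm_num
  · rw [if_pos (by decide), show certOddDvd2Log8.weights.getD 3 0 = 665112 from rfl]
    exact (h7 3 (by norm_num)).trans (by norm_num [wbar7])
  · rw [if_neg (by decide), show certOddDvd2Log8.weights.getD 4 0 = 0 from rfl]
    norm_num
  · rw [if_pos (by decide), show certOddDvd2Log8.weights.getD 5 0 = 754726 from rfl]
    exact (h7 5 (by norm_num)).trans (by norm_num [wbar7])
  · rw [if_neg (by decide), show certOddDvd2Log8.weights.getD 6 0 = 0 from rfl]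
    norm_num
  · rw [if_pos (by decide), show certOddDvd2Log8.weights.getD 7 0 = 771213 from rfl]
    exact (h7 7 (by norm_num)).trans (by norm_num [wbar7])
  · rw [if_neg (by decide), show certOddDvd2Log8.weights.getD 8 0 = 0 from rfl]
    norm_num

/-- The weights of `certEvenDvd3Log8` dominate `Λ(n)/√n` on the `n ≤ 8` prime to `3`; the other weights are `0`. [folklore] -/
theorem certEvenDvd3Log8_hw : ∀ n ∈ Finset.range (certEvenDvd3Log8.N + 1),
    (if n.Coprime 3 then (Λ n : ℝ) / Real.sqrt n else 0) ≤ certEvenDvd3Log8.wbar n := by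
  intro n hn
  have hnN : n < 9 := by simpa [show certEvenDvd3Log8.N = 8 from rfl] using Finset.mem_range.1 hn
  have h7 : ∀ k < 8, (Λ k : ℝ) / Real.sqrt k ≤ wbar7 k := fun k hk ↦
    wbar7_ge 7 le_rfl k (Finset.mem_range.2 (by omega))
  unfold JointCert.wbar
  rw [show certEvenDvd3Log8.D = 1048576 from rfl]
  interval_cases n
  · rw [if_neg (by decide), show certEvenDvd3Log8.weights.getD 0 0 = 0 from rfl]
    norm_num
  · rw [if_pos (by decide), show certEvenDvd3Log8.weights.getD 1 0 = 0 from rfl]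
    exact (h7 1 (by norm_num)).trans (by norm_num [wbar7])
  · rw [if_pos (by decide), show certEvenDvd3Log8.weights.getD 2 0 = 513950 from rfl]
    exact (h7 2 (by norm_num)).trans (by norm_num [wbar7])
  · rw [if_neg (by decide), show certEvenDvd3Log8.weights.getD 3 0 = 0 from rfl]
    norm_num
  · rw [if_pos (by decide), show certEvenDvd3Log8.weights.getD 4 0 = 363409 from rfl]
    exact (h7 4 (by norm_num)).trans (by norm_num [wbar7])
  · rw [if_pos (by decide), show certEvenDvd3Log8.weights.getD 5 0 = 754726 from rfl]
    exact (h7 5 (by norm_num)).trans (by norm_num [wbar7])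
  · rw [if_neg (by decide), show certEvenDvd3Log8.weights.getD 6 0 = 0 from rfl]
    norm_num
  · rw [if_pos (by decide), show certEvenDvd3Log8.weights.getD 7 0 = 771213 from rfl]
    exact (h7 7 (by norm_num)).trans (by norm_num [wbar7])
  · rw [if_pos (by decide), show certEvenDvd3Log8.weights.getD 8 0 = 256975 from rfl]
    simpa using vonMangoldt_eight_div_sqrt_le

/-- The weights of `certOddDvd3Log8` dominate `Λ(n)/√n` on the `n ≤ 8` prime to `3`; the other weights are `0`. [folklore] -/
theorem certOddDvd3Log8_hw : ∀ n ∈ Finset.range (certOddDvd3Log8.N + 1),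
    (if n.Coprime 3 then (Λ n : ℝ) / Real.sqrt n else 0) ≤ certOddDvd3Log8.wbar n := by
  intro n hn
  have hnN : n < 9 := by simpa [show certOddDvd3Log8.N = 8 from rfl] using Finset.mem_range.1 hn
  have h7 : ∀ k < 8, (Λ k : ℝ) / Real.sqrt k ≤ wbar7 k := fun k hk ↦
    wbar7_ge 7 le_rfl k (Finset.mem_range.2 (by omega))
  unfold JointCert.wbar
  rw [show certOddDvd3Log8.D = 1048576 from rfl]
  interval_cases n
  · rw [if_neg (by decide), show certOddDvd3Log8.weights.getD 0 0 = 0 from rfl]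
    norm_num
  · rw [if_pos (by decide), show certOddDvd3Log8.weights.getD 1 0 = 0 from rfl]
    exact (h7 1 (by norm_num)).trans (by norm_num [wbar7])
  · rw [if_pos (by decide), show certOddDvd3Log8.weights.getD 2 0 = 513950 from rfl]
    exact (h7 2 (by norm_num)).trans (by norm_num [wbar7])
  · rw [if_neg (by decide), show certOddDvd3Log8.weights.getD 3 0 = 0 from rfl]
    norm_num
  · rw [if_pos (by decide), show certOddDvd3Log8.weights.getD 4 0 = 363409 from rfl]
    exact (h7 4 (by norm_num)).trans (by norm_num [wbar7])
  · rw [if_pos (by decide), show certOddDvd3Log8.weights.getD 5 0 = 754726 from rfl]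
    exact (h7 5 (by norm_num)).trans (by norm_num [wbar7])
  · rw [if_neg (by decide), show certOddDvd3Log8.weights.getD 6 0 = 0 from rfl]
    norm_num
  · rw [if_pos (by decide), show certOddDvd3Log8.weights.getD 7 0 = 771213 from rfl]
    exact (h7 7 (by norm_num)).trans (by norm_num [wbar7])
  · rw [if_pos (by decide), show certOddDvd3Log8.weights.getD 8 0 = 256975 from rfl]
    simpa using vonMangoldt_eight_div_sqrt_le

/-- The weights of `certEvenDvd6Log8` dominate `Λ(n)/√n` on the `n ≤ 8` prime to `6`; the other weights are `0`. [folklore] -/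
theorem certEvenDvd6Log8_hw : ∀ n ∈ Finset.range (certEvenDvd6Log8.N + 1),
    (if n.Coprime 6 then (Λ n : ℝ) / Real.sqrt n else 0) ≤ certEvenDvd6Log8.wbar n := by
  intro n hn
  have hnN : n < 9 := by simpa [show certEvenDvd6Log8.N = 8 from rfl] using Finset.mem_range.1 hn
  have h7 : ∀ k < 8, (Λ k : ℝ) / Real.sqrt k ≤ wbar7 k := fun k hk ↦
    wbar7_ge 7 le_rfl k (Finset.mem_range.2 (by omega))
  unfold JointCert.wbar
  rw [show certEvenDvd6Log8.D = 1048576 from rfl]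
  interval_cases n
  · rw [if_neg (by decide), show certEvenDvd6Log8.weights.getD 0 0 = 0 from rfl]
    norm_num
  · rw [if_pos (by decide), show certEvenDvd6Log8.weights.getD 1 0 = 0 from rfl]
    exact (h7 1 (by norm_num)).trans (by norm_num [wbar7])
  · rw [if_neg (by decide), show certEvenDvd6Log8.weights.getD 2 0 = 0 from rfl]
    norm_num
  · rw [if_neg (by decide), show certEvenDvd6Log8.weights.getD 3 0 = 0 from rfl]
    norm_num
  · rw [if_neg (by decide), show certEvenDvd6Log8.weights.getD 4 0 = 0 from rfl]
    norm_num
  · rw [if_pos (by decide), show certEvenDvd6Log8.weights.getD 5 0 = 754726 from rfl]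
    exact (h7 5 (by norm_num)).trans (by norm_num [wbar7])
  · rw [if_neg (by decide), show certEvenDvd6Log8.weights.getD 6 0 = 0 from rfl]
    norm_num
  · rw [if_pos (by decide), show certEvenDvd6Log8.weights.getD 7 0 = 771213 from rfl]
    exact (h7 7 (by norm_num)).trans (by norm_num [wbar7])
  · rw [if_neg (by decide), show certEvenDvd6Log8.weights.getD 8 0 = 0 from rfl]
    norm_num

/-- The weights of `certOddDvd6Log8` dominate `Λ(n)/√n` on the `n ≤ 8` prime to `6`; the other weights are `0`. [folklore] -/
theorem certOddDvd6Log8_hw : ∀ n ∈ Finset.range (certOddDvd6Log8.N + 1),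
    (if n.Coprime 6 then (Λ n : ℝ) / Real.sqrt n else 0) ≤ certOddDvd6Log8.wbar n := by
  intro n hn
  have hnN : n < 9 := by simpa [show certOddDvd6Log8.N = 8 from rfl] using Finset.mem_range.1 hn
  have h7 : ∀ k < 8, (Λ k : ℝ) / Real.sqrt k ≤ wbar7 k := fun k hk ↦
    wbar7_ge 7 le_rfl k (Finset.mem_range.2 (by omega))
  unfold JointCert.wbar
  rw [show certOddDvd6Log8.D = 1048576 from rfl]
  interval_cases n
  · rw [if_neg (by decide), show certOddDvd6Log8.weights.getD 0 0 = 0 from rfl]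
    norm_num
  · rw [if_pos (by decide), show certOddDvd6Log8.weights.getD 1 0 = 0 from rfl]
    exact (h7 1 (by norm_num)).trans (by norm_num [wbar7])
  · rw [if_neg (by decide), show certOddDvd6Log8.weights.getD 2 0 = 0 from rfl]
    norm_num
  · rw [if_neg (by decide), show certOddDvd6Log8.weights.getD 3 0 = 0 from rfl]
    norm_num
  · rw [if_neg (by decide), show certOddDvd6Log8.weights.getD 4 0 = 0 from rfl]
    norm_num
  · rw [if_pos (by decide), show certOddDvd6Log8.weights.getD 5 0 = 754726 from rfl]
    exact (h7 5 (by norm_num)).trans (by norm_num [wbar7])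
  · rw [if_neg (by decide), show certOddDvd6Log8.weights.getD 6 0 = 0 from rfl]
    norm_num
  · rw [if_pos (by decide), show certOddDvd6Log8.weights.getD 7 0 = 771213 from rfl]
    exact (h7 7 (by norm_num)).trans (by norm_num [wbar7])
  · rw [if_neg (by decide), show certOddDvd6Log8.weights.getD 8 0 = 0 from rfl]
    norm_num

/-- The budget of `certEvenDvd2Log8`: `log π − (-4.22745354) − Clow/D + RHO/D = 3.683946 ≤ log 42` (`log 42 ≥ 4 log 2 + 1 log 3 − (48 − 42)/42 = 3.728344`). [folklore] -/
theorem certEvenDvd2Log8_budget :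
    Real.log Real.pi - (-4.22745354) - (certEvenDvd2Log8.Clow : ℝ) / certEvenDvd2Log8.D + (certEvenDvd2Log8.RHO : ℝ) / certEvenDvd2Log8.D ≤
      Real.log (42 : ℕ) := by
  have hπ := Literature.Analysis.SpecialFunctions.Real.log_pi_le
  have h2 := Real.log_two_gt_d9
  have h3 := Real.log_three_gt_d9
  have hl : Real.log ((48 : ℝ) / 42) ≤ 48 / 42 - 1 := Real.log_le_sub_one_of_pos (by norm_num)
  have hS : Real.log (48 : ℝ) = 4 * Real.log 2 + 1 * Real.log 3 := by
    rw [show (48 : ℝ) = 2 ^ 4 * 3 ^ 1 by norm_num, Real.log_mul (by norm_num) (by norm_num), Real.log_pow, Real.log_pow]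
    push_cast
    ring
  rw [Real.log_div (by norm_num) (by norm_num), hS] at hl
  rw [show certEvenDvd2Log8.Clow = 7676640 from rfl, show certEvenDvd2Log8.D = 1048576 from rfl,
    show certEvenDvd2Log8.RHO = 5906395 from rfl]
  push_cast at *
  linarith

/-- The budget of `certOddDvd2Log8`: `log π − (-1.08586154) − Clow/D + RHO/D = 2.734087 ≤ log 16` (`log 16 ≥ 4 log 2 + 0 log 3 − (16 − 16)/16 = 2.772589`). [folklore] -/
theorem certOddDvd2Log8_budget :
    Real.log Real.pi - (-1.08586154) - (certOddDvd2Log8.Clow : ℝ) / certOddDvd2Log8.D + (certOddDvd2Log8.RHO : ℝ) / certOddDvd2Log8.D ≤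
      Real.log (16 : ℕ) := by
  have hπ := Literature.Analysis.SpecialFunctions.Real.log_pi_le
  have h2 := Real.log_two_gt_d9
  have h3 := Real.log_three_gt_d9
  have hQ : Real.log (16 : ℝ) = 4 * Real.log 2 + 0 * Real.log 3 := by
    rw [show (16 : ℝ) = 2 ^ 4 * 3 ^ 0 by norm_num, Real.log_mul (by norm_num) (by norm_num), Real.log_pow, Real.log_pow]
    push_cast
    ring
  rw [show certOddDvd2Log8.Clow = 4399980 from rfl, show certOddDvd2Log8.D = 1048576 from rfl,
    show certOddDvd2Log8.RHO = 4927933 from rfl]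
  push_cast at *
  linarith

/-- The budget of `certEvenDvd3Log8`: `log π − (-4.22745354) − Clow/D + RHO/D = 3.962975 ≤ log 54` (`log 54 ≥ 1 log 2 + 3 log 3 − (54 − 54)/54 = 3.988984`). [folklore] -/
theorem certEvenDvd3Log8_budget :
    Real.log Real.pi - (-4.22745354) - (certEvenDvd3Log8.Clow : ℝ) / certEvenDvd3Log8.D + (certEvenDvd3Log8.RHO : ℝ) / certEvenDvd3Log8.D ≤
      Real.log (54 : ℕ) := by
  have hπ := Literature.Analysis.SpecialFunctions.Real.log_pi_le
  have h2 := Real.log_two_gt_d9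
  have h3 := Real.log_three_gt_d9
  have hQ : Real.log (54 : ℝ) = 1 * Real.log 2 + 3 * Real.log 3 := by
    rw [show (54 : ℝ) = 2 ^ 1 * 3 ^ 3 by norm_num, Real.log_mul (by norm_num) (by norm_num), Real.log_pow, Real.log_pow]
    push_cast
    ring
  rw [show certEvenDvd3Log8.Clow = 7676640 from rfl, show certEvenDvd3Log8.D = 1048576 from rfl,
    show certEvenDvd3Log8.RHO = 6198978 from rfl]
  push_cast at *
  linarith

/-- The budget of `certOddDvd3Log8`: `log π − (-1.08586154) − Clow/D + RHO/D = 3.005399 ≤ log 21` (`log 21 ≥ 3 log 2 + 1 log 3 − (24 − 21)/21 = 3.035197`). [folklore] -/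
theorem certOddDvd3Log8_budget :
    Real.log Real.pi - (-1.08586154) - (certOddDvd3Log8.Clow : ℝ) / certOddDvd3Log8.D + (certOddDvd3Log8.RHO : ℝ) / certOddDvd3Log8.D ≤
      Real.log (21 : ℕ) := by
  have hπ := Literature.Analysis.SpecialFunctions.Real.log_pi_le
  have h2 := Real.log_two_gt_d9
  have h3 := Real.log_three_gt_d9
  have hl : Real.log ((24 : ℝ) / 21) ≤ 24 / 21 - 1 := Real.log_le_sub_one_of_pos (by norm_num)
  have hS : Real.log (24 : ℝ) = 3 * Real.log 2 + 1 * Real.log 3 := by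
    rw [show (24 : ℝ) = 2 ^ 3 * 3 ^ 1 by norm_num, Real.log_mul (by norm_num) (by norm_num), Real.log_pow, Real.log_pow]
    push_cast
    ring
  rw [Real.log_div (by norm_num) (by norm_num), hS] at hl
  rw [show certOddDvd3Log8.Clow = 4399980 from rfl, show certOddDvd3Log8.D = 1048576 from rfl,
    show certOddDvd3Log8.RHO = 5212425 from rfl]
  push_cast at *
  linarith

/-- The budget of `certEvenDvd6Log8`: `log π − (-4.22745354) − Clow/D + RHO/D = 3.077856 ≤ log 24` (`log 24 ≥ 3 log 2 + 1 log 3 − (24 − 24)/24 = 3.178054`). [folklore] -/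
theorem certEvenDvd6Log8_budget :
    Real.log Real.pi - (-4.22745354) - (certEvenDvd6Log8.Clow : ℝ) / certEvenDvd6Log8.D + (certEvenDvd6Log8.RHO : ℝ) / certEvenDvd6Log8.D ≤
      Real.log (24 : ℕ) := by
  have hπ := Literature.Analysis.SpecialFunctions.Real.log_pi_le
  have h2 := Real.log_two_gt_d9
  have h3 := Real.log_three_gt_d9
  have hQ : Real.log (24 : ℝ) = 3 * Real.log 2 + 1 * Real.log 3 := by
    rw [show (24 : ℝ) = 2 ^ 3 * 3 ^ 1 by norm_num, Real.log_mul (by norm_num) (by norm_num), Real.log_pow, Real.log_pow]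
    push_cast
    ring
  rw [show certEvenDvd6Log8.Clow = 7676640 from rfl, show certEvenDvd6Log8.D = 1048576 from rfl,
    show certEvenDvd6Log8.RHO = 5270863 from rfl]
  push_cast at *
  linarith

/-- The budget of `certOddDvd6Log8`: `log π − (-1.08586154) − Clow/D + RHO/D = 2.137664 ≤ log 12` (`log 12 ≥ 2 log 2 + 1 log 3 − (12 − 12)/12 = 2.484907`). [folklore] -/
theorem certOddDvd6Log8_budget :
    Real.log Real.pi - (-1.08586154) - (certOddDvd6Log8.Clow : ℝ) / certOddDvd6Log8.D + (certOddDvd6Log8.RHO : ℝ) / certOddDvd6Log8.D ≤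
      Real.log (12 : ℕ) := by
  have hπ := Literature.Analysis.SpecialFunctions.Real.log_pi_le
  have h2 := Real.log_two_gt_d9
  have h3 := Real.log_three_gt_d9
  have hQ : Real.log (12 : ℝ) = 2 * Real.log 2 + 1 * Real.log 3 := by
    rw [show (12 : ℝ) = 2 ^ 2 * 3 ^ 1 by norm_num, Real.log_mul (by norm_num) (by norm_num), Real.log_pow, Real.log_pow]
    push_cast
    ring
  rw [show certOddDvd6Log8.Clow = 4399980 from rfl, show certOddDvd6Log8.D = 1048576 from rfl,
    show certOddDvd6Log8.RHO = 4302539 from rfl]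
  push_cast at *
  linarith

end UniformFloor

end Summit.Ventures.WeilGRH

end
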